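import Summits.BirchSwinnertonDyer.BirchSwinnertonDyer.Theorems.ManinLocalTwoThreeShimuraQuotientConjugation
import Summits.BirchSwinnertonDyer.BirchSwinnertonDyer.Theorems.ManinLocalTwoThreeShimuraDefectLawAtThree
import Summits.BirchSwinnertonDyer.BirchSwinnertonDyer.Theorems.ManinLocalTwoThreeThreeTorsionTangentSlope
import Literature.NumberTheory.EllipticCurves.RealLatticePeriod
import HarnessLib

/-!
# The Shimura kernel at `3` is of `μ₃`-type over `ℝ`: `Λ₁(f) ∩ ℝ ⊆ 3Λ₀(f)` and the kernel point `c₀w/3` is never `ℚ`-rational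

Summit `BirchSwinnertonDyer`, route `ManinLocalTwoThree` (cell bsd-f2-manin), crux C3 `ManinPrimeToThreeAtNine` (stmt-BirchSwinnertonDyer-22968);
lead p1 gen 14.  Sequel to `…ShimuraQuotientConjugation` (index `9` impossible) — the same mechanism (complex conjugation acts TRIVIALLY
on `Λ₀(f)/Λ₁(f)`, p2 g9 `conj_sub_self_mem_periodLatticeGamma1`) pins the index-`3` sublattice `Λ₁(f)`, `3Λ₀ ⊊ Λ₁ ⊊ Λ₀` at `9 ∣ N`:
`Λ₁/3Λ₀` is a conjugation-stable line of `Λ₀/3Λ₀ ≅ 𝔽₃²` with trivial action on the quotient, and conjugation on `Λ₀/3Λ₀` has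
eigenvalues `+1, −1`; so `Λ₁/3Λ₀` is the `(−1)`-eigenline:

* §1 `exists_sub_zsmul_mem_three_mul` — `𝔽₃`-linear algebra on a rank-`2` lattice `Λ = ℤω₁ ⊕ ℤω₂`: a PROPER subgroup `3Λ ⊆ S ⊊ Λ`
  is `3Λ + ℤr` for any `r ∈ S ∖ 3Λ` (coordinates mod `3`, `decide` on `𝔽₃`);
* §2 **`conj_add_self_mem_three_mul_of_mem_periodLatticeGamma1`** — at `9 ∣ N` with `Λ₁(f) ≠ Λ₀(f)`: **`w̄ + w ∈ 3Λ₀(f)` for every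
  `w ∈ Λ₁(f)`** (otherwise `r = w̄ + w ∈ Λ₁ ∖ 3Λ₀` is real, `Λ₁ = 3Λ₀ + ℤr`, and conjugation would act trivially on `Λ₀/3Λ₀`, excluded by
  `false_of_conj_sub_self_mem_natCast_mul`); corollary `mem_three_mul_of_mem_periodLatticeGamma1_of_conj_eq`: **`Λ₁(f) ∩ ℝ ⊆ 3Λ₀(f)`** —
  the real period of `E₀` is not a `Γ₁(N)`-period: `[Λ₀ ∩ ℝ : Λ₁ ∩ ℝ] = 3` whenever `Λ₁ ≠ Λ₀`;
* §3 **`conj_derivWeierstrassP_kernel`** — for a kernel generator `w ∈ Λ₁ ∖ 3Λ₀` the `3`-division point `P = c₀w/3 ∈ E₀[3]` has `P̄ = −P`: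
  `conj ℘'(c₀w/3) = −℘'(c₀w/3)` (and `℘(c₀w/3)` is real); hence **`no_rational_kernel_generator`** — NO rational point `(X₁, Y₁)` of order `3`
  of the short model `E♮(W₀)` has `X₁ = ℘(c₀w/3)`: `4Y₁² = ℘'(P)² ≤ 0` forces `Y₁ = 0`, impossible for a `3`-torsion point.  This is
  `…ShimuraDefectLawAtThreeEdges.no_rational_kernel_generator_of_noAscending` with BOTH its hypotheses (NB₃^V and `|c₀| = |c₁|`) REMOVED:
  the Shimura kernel `⟨P⟩ ⊂ E₀[3]` on the optimal curve is of `μ₃`-type (non-real points, real abscissa), never generated by a rational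
  `3`-torsion point; dually `ker(E₁ → E₀)` is generated by a rational `3`-torsion point of the Stevens curve.

HONEST FRAMING: unconditional structure theorems about the tree's lattices; they do NOT prove Manin's conjecture, C3 or BSD (all OPEN).
No definitions, no named facts, no sorry. [cite: Stevens1989, §2, Thm. 2.3] [cite: Manin1972, §1.6] [cite: Lawden1989, §6.15]
-/

set_option autoImplicit false
-- the summit-side namespace `Summit.BirchSwinnertonDyer.BirchSwinnertonDyer.…` is the tree's (summit = sub-problem)
set_option linter.dupNamespace false

noncomputable section

open scoped Classical ComplexConjugate
open WeierstrassCurve Literature.NumberTheory.EllipticCurves Literature.NumberTheory.EllipticCurves.ModularForms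
open CongruenceSubgroup Polynomial
open Summit.BirchSwinnertonDyer.Rank1Residual.ManinAdditive.CuspidalKummer
open Summit.BirchSwinnertonDyer.Rank1Residual.ManinAdditive.CuspidalKummerThree

namespace Summit.BirchSwinnertonDyer.BirchSwinnertonDyer.Theorems.ManinLocalTwoThree

/-! ## §1 `𝔽₃`-linear algebra on a rank-`2` lattice -/

/-- Integer coefficients with respect to `(ω₁, ω₂)` are unique. [folklore] -/
theorem PeriodPair.intCast_pair_eq_zero (L : PeriodPair) {s t : ℤ} (h : (s : ℂ) * L.ω₁ + (t : ℂ) * L.ω₂ = 0) :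
    s = 0 ∧ t = 0 := by
  have indep := LinearIndependent.pair_iff.mp L.indep (s : ℝ) (t : ℝ) (by
    rw [Complex.real_smul, Complex.real_smul, Complex.ofReal_intCast, Complex.ofReal_intCast]; exact h)
  exact ⟨by exact_mod_cast indep.1, by exact_mod_cast indep.2⟩

/-- `mω₁ + nω₂ ∈ 3Λ ⟺ 3 ∣ m ∧ 3 ∣ n`. [folklore] -/
theorem PeriodPair.exists_eq_three_mul_iff (L : PeriodPair) (m n : ℤ) :
    (∃ y ∈ L.lattice, (m : ℂ) * L.ω₁ + (n : ℂ) * L.ω₂ = 3 * y) ↔ (3 : ℤ) ∣ m ∧ (3 : ℤ) ∣ n := by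
  constructor
  · rintro ⟨y, hy, hmy⟩
    obtain ⟨m', n', rfl⟩ := PeriodPair.mem_lattice.mp hy
    have h0 : ((m - 3 * m' : ℤ) : ℂ) * L.ω₁ + ((n - 3 * n' : ℤ) : ℂ) * L.ω₂ = 0 := by
      push_cast; linear_combination hmy
    obtain ⟨h1, h2⟩ := PeriodPair.intCast_pair_eq_zero L h0
    exact ⟨⟨m', by linarith⟩, ⟨n', by linarith⟩⟩
  · rintro ⟨⟨a, rfl⟩, ⟨b, rfl⟩⟩
    refine ⟨a * L.ω₁ + b * L.ω₂, PeriodPair.mem_lattice.mpr ⟨a, b, rfl⟩, ?_⟩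
    push_cast; ring

/-- In `𝔽₃`, a nonzero element squares to `1`. -/
private theorem zmod3_mul_self_of_ne_zero : ∀ D : ZMod 3, D ≠ 0 → D * D = 1 := by decide

/-- In `𝔽₃²`, a vector with vanishing determinant against a nonzero vector is a multiple of it. -/
private theorem zmod3_exists_smul_of_det_eq_zero :
    ∀ a b m n : ZMod 3, (a ≠ 0 ∨ b ≠ 0) → a * n - b * m = 0 → ∃ k : ZMod 3, m = k * a ∧ n = k * b := by
  decide

/-- **A proper subgroup `3Λ ⊆ S ⊊ Λ` of a rank-`2` lattice is `3Λ + ℤr` for any `r ∈ S ∖ 3Λ`**: every `d ∈ S` has `d − kr ∈ 3Λ` for some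
`k ∈ ℤ` (coordinates mod `3`: if `(d, r)` had invertible determinant mod `3`, then `ω₁, ω₂ ∈ S`). [folklore] -/
theorem exists_sub_zsmul_mem_three_mul (L : PeriodPair) (S : AddSubgroup ℂ)
    (hS : ∀ x ∈ S, x ∈ L.lattice) (h3 : ∀ y ∈ L.lattice, 3 * y ∈ S) (hne : ∃ x ∈ L.lattice, x ∉ S)
    {r : ℂ} (hr : r ∈ S) (hr3 : ¬ ∃ y ∈ L.lattice, r = 3 * y) {d : ℂ} (hd : d ∈ S) :
    ∃ k : ℤ, ∃ y ∈ L.lattice, d - k * r = 3 * y := by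
  obtain ⟨a, b, hab⟩ := PeriodPair.mem_lattice.mp (hS r hr)
  obtain ⟨m, n, hmn⟩ := PeriodPair.mem_lattice.mp (hS d hd)
  -- membership in `3Λ` of an integer combination, via §1
  have h3mem : ∀ u v : ℤ, (3 : ℤ) ∣ u → (3 : ℤ) ∣ v → ∃ y ∈ L.lattice, (u : ℂ) * L.ω₁ + (v : ℂ) * L.ω₂ = 3 * y :=
    fun u v hu hv ↦ (PeriodPair.exists_eq_three_mul_iff L u v).mpr ⟨hu, hv⟩
  by_cases hdet : (a : ZMod 3) * (n : ZMod 3) - (b : ZMod 3) * (m : ZMod 3) = 0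
  · -- `d ≡ k r (mod 3Λ)`
    have hab0 : (a : ZMod 3) ≠ 0 ∨ (b : ZMod 3) ≠ 0 := by
      by_contra hcon
      push Not at hcon
      have ha : (3 : ℤ) ∣ a := (ZMod.intCast_zmod_eq_zero_iff_dvd a 3).mp hcon.1
      have hb : (3 : ℤ) ∣ b := (ZMod.intCast_zmod_eq_zero_iff_dvd b 3).mp hcon.2
      obtain ⟨y, hy, hy'⟩ := h3mem a b ha hb
      exact hr3 ⟨y, hy, by rw [← hab, hy']⟩
    obtain ⟨k, hkm, hkn⟩ := zmod3_exists_smul_of_det_eq_zero _ _ _ _ hab0 hdet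
    refine ⟨(k.val : ℤ), ?_⟩
    have hk : ((k.val : ℕ) : ZMod 3) = k := ZMod.natCast_zmod_val k
    have hm3 : (3 : ℤ) ∣ m - k.val * a := by
      refine (ZMod.intCast_zmod_eq_zero_iff_dvd _ 3).mp ?_
      push_cast; rw [hk, hkm]; ring
    have hn3 : (3 : ℤ) ∣ n - k.val * b := by
      refine (ZMod.intCast_zmod_eq_zero_iff_dvd _ 3).mp ?_
      push_cast; rw [hk, hkn]; ring
    obtain ⟨y, hy, hy'⟩ := h3mem _ _ hm3 hn3
    refine ⟨y, hy, ?_⟩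
    rw [← hy', ← hmn, ← hab]; push_cast; ring
  · -- invertible determinant mod 3: then `ω₁, ω₂ ∈ S`, contradiction
    exfalso
    set D : ZMod 3 := (a : ZMod 3) * (n : ZMod 3) - (b : ZMod 3) * (m : ZMod 3) with hD
    have hDD : D * D = 1 := zmod3_mul_self_of_ne_zero D hdet
    -- integer lifts of `s = D n`, `t = −D b`, `u = −D m`, `v = D a`
    set s : ℤ := ((D * (n : ZMod 3)).val : ℤ) with hs
    set t : ℤ := ((-(D * (b : ZMod 3))).val : ℤ) with ht
    set u : ℤ := ((-(D * (m : ZMod 3))).val : ℤ) with hu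
    set v : ℤ := ((D * (a : ZMod 3)).val : ℤ) with hv
    have hs' : (s : ZMod 3) = D * (n : ZMod 3) := by rw [hs]; simp
    have ht' : (t : ZMod 3) = -(D * (b : ZMod 3)) := by rw [ht]; simp
    have hu' : (u : ZMod 3) = -(D * (m : ZMod 3)) := by rw [hu]; simp
    have hv' : (v : ZMod 3) = D * (a : ZMod 3) := by rw [hv]; simp
    have h1 : (3 : ℤ) ∣ s * a + t * m - 1 := by
      refine (ZMod.intCast_zmod_eq_zero_iff_dvd _ 3).mp ?_
      push_cast; rw [hs', ht']; linear_combination hDD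
    have h2 : (3 : ℤ) ∣ s * b + t * n := by
      refine (ZMod.intCast_zmod_eq_zero_iff_dvd _ 3).mp ?_
      push_cast; rw [hs', ht']; ring
    have h3' : (3 : ℤ) ∣ u * a + v * m := by
      refine (ZMod.intCast_zmod_eq_zero_iff_dvd _ 3).mp ?_
      push_cast; rw [hu', hv']; ring
    have h4 : (3 : ℤ) ∣ u * b + v * n - 1 := by
      refine (ZMod.intCast_zmod_eq_zero_iff_dvd _ 3).mp ?_
      push_cast; rw [hu', hv']; linear_combination hDD
    obtain ⟨y₁, hy₁, hy₁'⟩ := h3mem _ _ h1 h2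
    obtain ⟨y₂, hy₂, hy₂'⟩ := h3mem _ _ h3' h4
    have hω₁ : L.ω₁ ∈ S := by
      have he : L.ω₁ = ((s : ℂ) * r + (t : ℂ) * d) - 3 * y₁ := by
        rw [← hy₁', ← hab, ← hmn]; push_cast; ring
      rw [he]
      refine S.sub_mem (S.add_mem ?_ ?_) (h3 y₁ hy₁)
      · simpa [zsmul_eq_mul] using S.zsmul_mem hr s
      · simpa [zsmul_eq_mul] using S.zsmul_mem hd t
    have hω₂ : L.ω₂ ∈ S := by
      have he : L.ω₂ = ((u : ℂ) * r + (v : ℂ) * d) - 3 * y₂ := by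
        rw [← hy₂', ← hab, ← hmn]; push_cast; ring
      rw [he]
      refine S.sub_mem (S.add_mem ?_ ?_) (h3 y₂ hy₂)
      · simpa [zsmul_eq_mul] using S.zsmul_mem hr u
      · simpa [zsmul_eq_mul] using S.zsmul_mem hd v
    obtain ⟨x, hx, hxS⟩ := hne
    obtain ⟨m'', n'', rfl⟩ := PeriodPair.mem_lattice.mp hx
    refine hxS (S.add_mem ?_ ?_)
    · simpa [zsmul_eq_mul] using S.zsmul_mem hω₁ m''
    · simpa [zsmul_eq_mul] using S.zsmul_mem hω₂ n''

/-! ## §2 The `(−1)`-eigenline: `w̄ + w ∈ 3Λ₀(f)` on `Λ₁(f)` -/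

section Data

variable {W₀ : WeierstrassCurve ℚ} {N : ℕ} [NeZero N]

/-- `Λ₀(f)` is conjugation-stable for `f` with real coefficients (`z̄ = (z̄ − z) + z`, `z̄ − z ∈ Λ₁(f) ≤ Λ₀(f)`). [cite: Manin1972, §1.6] -/
theorem conj_mem_periodLattice_of_real {f : CuspForm (Gamma0 N) 2} (h : ∀ n, (cuspCoeff f n).im = 0) {z : ℂ}
    (hz : z ∈ periodLattice f) : conj z ∈ periodLattice f := by
  have h1 := periodLatticeGamma1_le_periodLattice f (conj_sub_self_mem_periodLatticeGamma1 h hz)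
  have : conj z = (conj z - z) + z := by ring
  rw [this]; exact add_mem h1 hz

/-- The Néron lattice of a lattice-optimal `X₀(N)`-datum is conjugation-stable (`Λ_{E₀} = c₀Λ₀(f)`, `Λ₀(f)` is conjugation-stable for
the real newform). [folklore] -/
theorem isReal_of_latticeOptimal (D₀ : ModularParametrizationData W₀ N)
    (h₀ : ∀ z ∈ D₀.L.lattice, ∃ w ∈ periodLattice D₀.f, z = D₀.c * w) : D₀.L.IsReal := by
  intro z hz
  obtain ⟨w, hw, rfl⟩ := h₀ z hz
  rw [map_mul, map_intCast]
  exact D₀.smul_periodLattice_le _ (conj_mem_periodLattice_of_real D₀.isNewformOf.1.cuspCoeff_im_eq_zero hw)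

/-- Transport: `z̄ − z ∈ pΛ₀(f)` on `Λ₀(f)` gives `z̄ − z ∈ pΛ_{E₀}` on the Néron lattice of a lattice-optimal datum. [folklore] -/
theorem conj_sub_self_mem_natCast_mul_lattice_of_periodLattice (D₀ : ModularParametrizationData W₀ N)
    (h₀ : ∀ z ∈ D₀.L.lattice, ∃ w ∈ periodLattice D₀.f, z = D₀.c * w) {p : ℕ}
    (h : ∀ z ∈ periodLattice D₀.f, ∃ y ∈ periodLattice D₀.f, conj z - z = (p : ℂ) * y) :
    ∀ z ∈ D₀.L.lattice, ∃ y ∈ D₀.L.lattice, conj z - z = (p : ℂ) * y := by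
  intro z hz
  obtain ⟨w, hw, rfl⟩ := h₀ z hz
  obtain ⟨y, hy, hyw⟩ := h w hw
  refine ⟨D₀.c * y, D₀.smul_periodLattice_le y hy, ?_⟩
  rw [map_mul, map_intCast, ← mul_sub, hyw]; ring

/-- **The `(−1)`-eigenline.**  At `9 ∣ N`, if `Λ₁(f) ≠ Λ₀(f)` then `w̄ + w ∈ 3Λ₀(f)` for every `w ∈ Λ₁(f)`: the kernel point `P = c₀w/3`
satisfies `P̄ = −P` in `E₀ = ℂ/Λ_{E₀}`.  Proof: else `r = w̄ + w ∈ Λ₁ ∖ 3Λ₀` is real, `Λ₁ = 3Λ₀ + ℤr` (§1), and for `z ∈ Λ₀` the element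
`d = z̄ − z ∈ Λ₁` satisfies `d − kr ∈ 3Λ₀`, `d̄ = −d`, whence `2d ∈ 3Λ₀`, `d ∈ 3Λ₀` — conjugation trivial on `Λ₀/3Λ₀`, excluded by
`false_of_conj_sub_self_mem_natCast_mul`.  Unconditional. [cite: Stevens1989, §2] -/
theorem conj_add_self_mem_three_mul_of_mem_periodLatticeGamma1 (D₀ : ModularParametrizationData W₀ N)
    (h₀ : ∀ z ∈ D₀.L.lattice, ∃ w ∈ periodLattice D₀.f, z = D₀.c * w) (h9 : 3 ^ 2 ∣ N)
    (hΛne : periodLatticeGamma1 D₀.f ≠ periodLattice D₀.f)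
    {w : ℂ} (hw : w ∈ periodLatticeGamma1 D₀.f) : ∃ v ∈ periodLattice D₀.f, conj w + w = 3 * v := by
  have hreal : ∀ n, (cuspCoeff D₀.f n).im = 0 := D₀.isNewformOf.1.cuspCoeff_im_eq_zero
  have hc₀ : (D₀.c : ℂ) ≠ 0 := by exact_mod_cast D₀.maninConstant_ne_zero_holds
  have hle := periodLatticeGamma1_le_periodLattice D₀.f
  have h3Λ : ∀ v ∈ periodLattice D₀.f, (3 : ℂ) * v ∈ periodLatticeGamma1 D₀.f := fun v hv ↦ by
    have h := pMulLatticeLeGamma1OfTracelessPrime_holds N D₀.f D₀.isNewformOf.1 3 Nat.prime_three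
      ((dvd_pow_self 3 two_ne_zero).trans h9) (D₀.isNewformOf.1.cuspCoeff_eq_zero_of_sq_dvd Nat.prime_three h9) v hv
    exact_mod_cast h
  -- the rescaled period pair `L₀ = c₀⁻¹ Λ_{E₀}` spans `Λ₀(f)`
  set L₀ : PeriodPair := D₀.L.mulLeft ((D₀.c : ℂ)⁻¹) (inv_ne_zero hc₀) with hL₀
  have hF : ∀ x : ℂ, x ∈ L₀.lattice ↔ x ∈ periodLattice D₀.f := by
    intro x
    rw [hL₀, PeriodPair.mem_mulLeft_lattice, inv_inv]
    constructor
    · intro hx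
      obtain ⟨w', hw', he⟩ := h₀ _ hx
      have : x = w' := mul_left_cancel₀ hc₀ he
      rw [this]; exact hw'
    · intro hx; exact D₀.smul_periodLattice_le x hx
  by_contra hcon
  push Not at hcon
  -- `r = w̄ + w ∈ Λ₁ ∖ 3Λ₀`
  have hcw : conj w ∈ periodLatticeGamma1 D₀.f := by
    have h1 := conj_sub_self_mem_periodLatticeGamma1 hreal (hle hw)
    have : conj w = (conj w - w) + w := by ring
    rw [this]; exact add_mem h1 hw
  have hr : conj w + w ∈ periodLatticeGamma1 D₀.f := add_mem hcw hw
  have hr3 : ¬ ∃ y ∈ L₀.lattice, conj w + w = 3 * y := by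
    rintro ⟨y, hy, hy'⟩; exact hcon y ((hF y).mp hy) hy'
  have hne' : ∃ x ∈ L₀.lattice, x ∉ periodLatticeGamma1 D₀.f := by
    by_contra hall
    push Not at hall
    exact hΛne (le_antisymm hle fun x hx ↦ hall x ((hF x).mpr hx))
  -- conjugation would act trivially on `Λ₀/3Λ₀`
  have htriv : ∀ z ∈ periodLattice D₀.f, ∃ y ∈ periodLattice D₀.f, conj z - z = ((3 : ℕ) : ℂ) * y := by
    intro z hz
    have hd : conj z - z ∈ periodLatticeGamma1 D₀.f := conj_sub_self_mem_periodLatticeGamma1 hreal hz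
    obtain ⟨k, y, hy, hky⟩ := exists_sub_zsmul_mem_three_mul L₀ (periodLatticeGamma1 D₀.f)
      (fun x hx ↦ (hF x).mpr (hle hx)) (fun y hy ↦ h3Λ y ((hF y).mp hy)) hne' hr hr3 hd
    have hyΛ : y ∈ periodLattice D₀.f := (hF y).mp hy
    have hcy : conj y ∈ periodLattice D₀.f := conj_mem_periodLattice_of_real hreal hyΛ
    -- conjugate the relation: `conj(z̄ − z) = −(z̄ − z)`, `conj(w̄ + w) = w̄ + w`
    have hconj : -(conj z - z) - (k : ℂ) * (conj w + w) = 3 * conj y := by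
      have := congrArg conj hky
      simp only [map_sub, map_mul, map_add, map_intCast, map_ofNat, Complex.conj_conj] at this
      linear_combination this
    refine ⟨(conj z - z) - y + conj y, add_mem (sub_mem (hle hd) hyΛ) hcy, ?_⟩
    push_cast
    linear_combination hconj - hky
  exact false_of_conj_sub_self_mem_natCast_mul D₀.L (p := 3) le_rfl
    (conj_sub_self_mem_natCast_mul_lattice_of_periodLattice D₀ h₀ htriv)

/-- **`Λ₁(f) ∩ ℝ ⊆ 3Λ₀(f)`** at `9 ∣ N` when `Λ₁(f) ≠ Λ₀(f)`: a REAL `Γ₁(N)`-period is a triple `Γ₀(N)`-period; in particular the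
real period of `E₀` is not a `Γ₁(N)`-period (`[Λ₀ ∩ ℝ : Λ₁ ∩ ℝ] = 3`).  Unconditional. [cite: Stevens1989, §2] -/
theorem exists_eq_three_mul_of_mem_periodLatticeGamma1_of_conj_eq (D₀ : ModularParametrizationData W₀ N)
    (h₀ : ∀ z ∈ D₀.L.lattice, ∃ w ∈ periodLattice D₀.f, z = D₀.c * w) (h9 : 3 ^ 2 ∣ N)
    (hΛne : periodLatticeGamma1 D₀.f ≠ periodLattice D₀.f)
    {w : ℂ} (hw : w ∈ periodLatticeGamma1 D₀.f) (hwr : conj w = w) : ∃ v ∈ periodLattice D₀.f, w = 3 * v := by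
  obtain ⟨v, hv, hvw⟩ := conj_add_self_mem_three_mul_of_mem_periodLatticeGamma1 D₀ h₀ h9 hΛne hw
  rw [hwr] at hvw
  refine ⟨w - v, sub_mem (periodLatticeGamma1_le_periodLattice D₀.f hw) hv, ?_⟩
  linear_combination -hvw

/-! ## §3 The kernel point `P = c₀w/3`: `P̄ = −P`, so it is never a rational point -/

/-- **`conj ℘'(c₀w/3) = −℘'(c₀w/3)`** for `w ∈ Λ₁(f)` at `9 ∣ N` with `Λ₁ ≠ Λ₀`: the kernel point `P = c₀w/3` has `P̄ = −P` (§2), the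
Néron lattice is real (`℘'(z̄) = conj ℘'(z)`), and `℘'` is odd and `Λ`-periodic.  Unconditional. [cite: Lawden1989, §6.15] -/
theorem conj_derivWeierstrassP_kernel (D₀ : ModularParametrizationData W₀ N)
    (h₀ : ∀ z ∈ D₀.L.lattice, ∃ w ∈ periodLattice D₀.f, z = D₀.c * w) (h9 : 3 ^ 2 ∣ N)
    (hΛne : periodLatticeGamma1 D₀.f ≠ periodLattice D₀.f) {w : ℂ} (hw : w ∈ periodLatticeGamma1 D₀.f) :
    conj (D₀.L.derivWeierstrassP ((D₀.c : ℂ) * w / 3)) = - D₀.L.derivWeierstrassP ((D₀.c : ℂ) * w / 3) := by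
  obtain ⟨v, hv, hvw⟩ := conj_add_self_mem_three_mul_of_mem_periodLatticeGamma1 D₀ h₀ h9 hΛne hw
  have hR : D₀.L.IsReal := isReal_of_latticeOptimal D₀ h₀
  have hcv : (D₀.c : ℂ) * v ∈ D₀.L.lattice := D₀.smul_periodLattice_le v hv
  have hconjz : conj ((D₀.c : ℂ) * w / 3) = -((D₀.c : ℂ) * w / 3) + (D₀.c : ℂ) * v := by
    have hcw : conj w = 3 * v - w := by linear_combination hvw
    rw [map_div₀, map_mul, map_intCast, map_ofNat, hcw]; ring
  rw [← hR.derivWeierstrassP_conj, hconjz]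
  have := D₀.L.derivWeierstrassP_add_coe (-((D₀.c : ℂ) * w / 3)) ⟨_, hcv⟩
  rw [this, PeriodPair.derivWeierstrassP_neg]

/-- **`℘(c₀w/3)` is real** for `w ∈ Λ₁(f)` (`9 ∣ N`, `Λ₁ ≠ Λ₀`): `conj ℘(P) = ℘(P̄) = ℘(−P) = ℘(P)`. Unconditional. [cite: Lawden1989, §6.15] -/
theorem conj_weierstrassP_kernel (D₀ : ModularParametrizationData W₀ N)
    (h₀ : ∀ z ∈ D₀.L.lattice, ∃ w ∈ periodLattice D₀.f, z = D₀.c * w) (h9 : 3 ^ 2 ∣ N)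
    (hΛne : periodLatticeGamma1 D₀.f ≠ periodLattice D₀.f) {w : ℂ} (hw : w ∈ periodLatticeGamma1 D₀.f) :
    conj (D₀.L.weierstrassP ((D₀.c : ℂ) * w / 3)) = D₀.L.weierstrassP ((D₀.c : ℂ) * w / 3) := by
  obtain ⟨v, hv, hvw⟩ := conj_add_self_mem_three_mul_of_mem_periodLatticeGamma1 D₀ h₀ h9 hΛne hw
  have hR : D₀.L.IsReal := isReal_of_latticeOptimal D₀ h₀
  have hcv : (D₀.c : ℂ) * v ∈ D₀.L.lattice := D₀.smul_periodLattice_le v hv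
  have hconjz : conj ((D₀.c : ℂ) * w / 3) = -((D₀.c : ℂ) * w / 3) + (D₀.c : ℂ) * v := by
    have hcw : conj w = 3 * v - w := by linear_combination hvw
    rw [map_div₀, map_mul, map_intCast, map_ofNat, hcw]; ring
  rw [← hR.weierstrassP_conj, hconjz]
  have := D₀.L.weierstrassP_add_coe (-((D₀.c : ℂ) * w / 3)) ⟨_, hcv⟩
  rw [this, PeriodPair.weierstrassP_neg]

/-- **The Shimura kernel point is never `ℚ`-rational (UNCONDITIONAL).**  For a lattice-optimal `X₀(N)`-datum at `9 ∣ N` with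
`Λ₁(f) ≠ Λ₀(f)` and a kernel generator `w ∈ Λ₁(f) ∖ 3Λ₀(f)`, no rational point `(X₁, Y₁)` of order `3` of the short model `E♮(W₀)`
has abscissa `X₁ = ℘(c₀w/3)`: the short-model equation reads `4Y₁² = ℘'(c₀w/3)²`, and `℘'(c₀w/3)` is purely imaginary (§3), so
`Y₁ = 0` — impossible for a `3`-torsion point (`y_ne_zero_of_isShortThreeTorsion`).  This removes BOTH hypotheses (NB₃^V, `|c₀| = |c₁|`)
of `…ShimuraDefectLawAtThreeEdges.no_rational_kernel_generator_of_noAscending`: the Shimura kernel `⟨c₀w/3⟩ ⊂ E₀[3]` is of `μ₃`-type,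
never `ℤ/3`.  Does not prove C3. [cite: Stevens1989, §2, Thm. 2.3] -/
theorem no_rational_kernel_generator (D₀ : ModularParametrizationData W₀ N)
    (h₀ : ∀ z ∈ D₀.L.lattice, ∃ w ∈ periodLattice D₀.f, z = D₀.c * w) (h9 : 3 ^ 2 ∣ N)
    (hΛne : periodLatticeGamma1 D₀.f ≠ periodLattice D₀.f)
    {w : ℂ} (hw : w ∈ periodLatticeGamma1 D₀.f) (hw3 : ∀ v ∈ periodLattice D₀.f, w ≠ 3 * v)
    {X₁ Y₁ : ℚ} (hT : IsShortThreeTorsion W₀ 1 X₁ Y₁) :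
    (X₁ : ℂ) ≠ D₀.L.weierstrassP ((D₀.c : ℂ) * w / 3) := by
  intro hx
  have hc₀ : (D₀.c : ℂ) ≠ 0 := by exact_mod_cast D₀.maninConstant_ne_zero_holds
  set z : ℂ := (D₀.c : ℂ) * w / 3 with hz
  -- `z ∉ Λ_{E₀}` (else `w ∈ 3Λ₀`)
  have hzΛ : z ∉ D₀.L.lattice := by
    intro hmem
    obtain ⟨v, hv, hvz⟩ := h₀ z hmem
    refine hw3 v hv (mul_left_cancel₀ hc₀ ?_)
    have : (D₀.c : ℂ) * w = 3 * z := by rw [hz]; ring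
    rw [this, hvz]; ring
  -- `℘'(z)` is purely imaginary
  have him : (D₀.L.derivWeierstrassP z).re = 0 := by
    have h := conj_derivWeierstrassP_kernel D₀ h₀ h9 hΛne hw
    have h2 := congrArg Complex.re h
    simp only [Complex.conj_re, Complex.neg_re] at h2
    linarith
  -- the short-model equation: `4Y₁² = ℘'(z)²`
  have hc₄W : (W₀.baseChange ℂ).c₄ = (W₀.c₄ : ℂ) := by simp [WeierstrassCurve.baseChange, WeierstrassCurve.map_c₄]
  have hc₆W : (W₀.baseChange ℂ).c₆ = (W₀.c₆ : ℂ) := by simp [WeierstrassCurve.baseChange, WeierstrassCurve.map_c₆]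
  have hg₂ : D₀.L.g₂ = (W₀.c₄ : ℂ) / 12 := by rw [D₀.isNeronLattice.1, hc₄W]
  have hg₃ : D₀.L.g₃ = (W₀.c₆ : ℂ) / 216 := by rw [D₀.isNeronLattice.2, hc₆W]
  have hsq := D₀.L.derivWeierstrassP_sq z hzΛ
  have heq := equation_of_isShortThreeTorsion hT
  have ha₄ : (shortModel W₀ 1).a₄ = -((1 : ℚ) ^ 4 * W₀.c₄ / 48) := rfl
  have ha₆ : (shortModel W₀ 1).a₆ = -((1 : ℚ) ^ 6 * W₀.c₆ / 864) := rfl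
  rw [ha₄, ha₆] at heq
  have heqC : (4 : ℂ) * ((Y₁ : ℚ) : ℂ) ^ 2 = D₀.L.derivWeierstrassP z ^ 2 := by
    rw [hsq, hg₂, hg₃, ← hx]
    have := congrArg (fun q : ℚ ↦ ((q : ℚ) : ℂ)) heq
    push_cast at this ⊢
    linear_combination 4 * this
  -- real parts: `4Y₁² = re(℘'²) = −im(℘')²`
  have hre := congrArg Complex.re heqC
  have lhs : ((4 : ℂ) * ((Y₁ : ℚ) : ℂ) ^ 2).re = 4 * (Y₁ : ℝ) ^ 2 := by
    have : (4 : ℂ) * ((Y₁ : ℚ) : ℂ) ^ 2 = ((4 * (Y₁ : ℝ) ^ 2 : ℝ) : ℂ) := by push_cast; ring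
    rw [this, Complex.ofReal_re]
  have rhs : (D₀.L.derivWeierstrassP z ^ 2).re = -(D₀.L.derivWeierstrassP z).im ^ 2 := by
    rw [pow_two, Complex.mul_re, him]; ring
  rw [lhs, rhs] at hre
  have hY : (Y₁ : ℝ) = 0 := by nlinarith [sq_nonneg (Y₁ : ℝ), sq_nonneg (D₀.L.derivWeierstrassP z).im]
  exact y_ne_zero_of_isShortThreeTorsion hT (by exact_mod_cast hY)

end Data

end Summit.BirchSwinnertonDyer.BirchSwinnertonDyer.Theorems.ManinLocalTwoThree

end
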